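import Mathlib.Analysis.SpecialFunctions.Pow.Real
import Mathlib.Analysis.SpecialFunctions.Log.Basic
import HarnessLib

/-!
# Cell abc-stewartyu, WP-L.P(odd) (crux r3 `PadicCoreOddRat`, stmt-ABC-20503): the two LINE SHAPES of the inequality pack as pure real algebra
# (k-step: `max (Bw·Λ·q₁·q₂) (Bw/ρ^E) < 1/K`; half-step: `… < D/M^e`), budget-parametric

`Summits/ABC/StewartYu/PadicG3SatLineAlg.lean` — cell `abc-stewartyu` (seat p2-g6; pack twin).  Proofs only; no definition, no named fact; Mathlib only.
The k-step and half-step LINES of every Gen-3 pack (`PadicG3VbLinesK.kstep_line_Vb`, `PadicG3VbHalfLine.half_line_Vb`, their 2-adic and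
saturated twins) share one piece of real algebra once the sizes are in log form: with `log K ≤ Kb`, `Bw ≤ e^B`, `‖Λ/b‖ ≤ e^{−U}`, `q₁ ≤ e^{A₁}`,
`q₂ ≤ e^{A₂}`, `ρ^E = e^{GE}`, the FAR budget `B + Kb < GE` and the `Λ` budget `B − U + A₁ + A₂ + Kb < 0` give the k-step line; with a threshold
`M ≤ e^{Mb}`, `D ≥ 1` and the budgets `B + e·Mb < GE`, `B − U + A₁ + A₂ + e·Mb < 0` they give the half-step line.  The record's budget theorems
(p1 g10, `PadicG3ParNF`) instantiate `Kb`, `Mb`, `B`, `U`, `A₁`, `A₂`, `GE`.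

* `kstep_line_of_budget`, `half_line_of_budget`.

References: Yu. V. Nesterenko, LNM 1819 (2003) §4.2 (4.29)–(4.35), §4.3 (4.38)–(4.45) (shape only).
-/

noncomputable section

namespace Summit.ABC.StewartYu

namespace SatLineAlg

/-- **The k-step line from the two budgets** (far: `B + Kb < GE`; `Λ`: `B − U + A₁ + A₂ + Kb < 0`).
[cite: Nesterenko2003, §4.2 (4.34)–(4.35); shape only] -/
theorem kstep_line_of_budget {K Bw Λn q₁ q₂ ρE Kb B U A₁ A₂ GE : ℝ} (hK : 0 < K) (hKlog : Real.log K ≤ Kb)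
    (hBw : Bw ≤ Real.exp B) (hΛ0 : 0 ≤ Λn) (hΛU : Λn ≤ Real.exp (-U))
    (hq1 : 0 ≤ q₁) (hq1e : q₁ ≤ Real.exp A₁) (hq2 : 0 ≤ q₂) (hq2e : q₂ ≤ Real.exp A₂)
    (hρ : ρE = Real.exp GE) (hfar : B + Kb < GE) (hlam : B - U + A₁ + A₂ + Kb < 0) :
    max (Bw * Λn * q₁ * q₂) (Bw / ρE) < 1 / K := by
  have hKexp : K ≤ Real.exp Kb := by rw [← Real.exp_log hK]; exact Real.exp_le_exp.mpr hKlog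
  refine max_lt ?_ ?_
  · -- Λ branch
    rw [lt_div_iff₀ hK]
    calc Bw * Λn * q₁ * q₂ * K ≤ Real.exp B * Real.exp (-U) * Real.exp A₁ * Real.exp A₂ * Real.exp Kb := by gcongr
      _ = Real.exp (B - U + A₁ + A₂ + Kb) := by rw [← Real.exp_add, ← Real.exp_add, ← Real.exp_add, ← Real.exp_add]; ring_nf
      _ < 1 := Real.exp_lt_one_iff.mpr hlam
  · -- far branch
    rw [hρ, lt_div_iff₀ hK, div_mul_eq_mul_div, div_lt_iff₀ (Real.exp_pos _), one_mul]
    calc Bw * K ≤ Real.exp B * Real.exp Kb := mul_le_mul hBw hKexp hK.le (Real.exp_pos _).le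
      _ = Real.exp (B + Kb) := by rw [← Real.exp_add]
      _ < Real.exp GE := Real.exp_lt_exp.mpr hfar

/-- **The half-step line from the two budgets** (threshold `M ≤ e^{Mb}` raised to `e`, denominator `D ≥ 1`; far: `B + e·Mb < GE`;
`Λ`: `B − U + A₁ + A₂ + e·Mb < 0`). [cite: Nesterenko2003, §4.3 (4.44)–(4.45); shape only] -/
theorem half_line_of_budget {M D Bw Λn q₁ q₂ ρE Mb B U A₁ A₂ GE : ℝ} {e : ℕ} (hM : 0 < M) (hMlog : Real.log M ≤ Mb) (hD1 : 1 ≤ D)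
    (hBw0 : 0 < Bw) (hBw : Bw ≤ Real.exp B) (hΛ0 : 0 ≤ Λn) (hΛU : Λn ≤ Real.exp (-U))
    (hq1 : 0 ≤ q₁) (hq1e : q₁ ≤ Real.exp A₁) (hq2 : 0 ≤ q₂) (hq2e : q₂ ≤ Real.exp A₂)
    (hρ : ρE = Real.exp GE) (hfar : B + e * Mb < GE) (hlam : B - U + A₁ + A₂ + e * Mb < 0) :
    max (Bw * Λn * q₁ * q₂) (Bw / ρE) < D / M ^ e := by
  have hMe : M ^ e ≤ Real.exp (e * Mb) := by
    have h1 : M ≤ Real.exp Mb := by rw [← Real.exp_log hM]; exact Real.exp_le_exp.mpr hMlog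
    calc M ^ e ≤ (Real.exp Mb) ^ e := pow_le_pow_left₀ hM.le h1 _
      _ = Real.exp (e * Mb) := by rw [← Real.exp_nat_mul]
  have hMepos : 0 < M ^ e := pow_pos hM _
  -- reduce both branches to `term · M^e < 1 ≤ D`
  have hgoal : ∀ a : ℝ, 0 ≤ a → a * M ^ e < 1 → a < D / M ^ e := by
    intro a _ h
    rw [lt_div_iff₀ hMepos]
    linarith
  refine max_lt (hgoal _ (by positivity) ?_) (hgoal _ ?_ ?_)
  · calc Bw * Λn * q₁ * q₂ * M ^ e ≤ Real.exp B * Real.exp (-U) * Real.exp A₁ * Real.exp A₂ * Real.exp (e * Mb) := by gcongr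
      _ = Real.exp (B - U + A₁ + A₂ + e * Mb) := by
          rw [← Real.exp_add, ← Real.exp_add, ← Real.exp_add, ← Real.exp_add]; ring_nf
      _ < 1 := Real.exp_lt_one_iff.mpr hlam
  · rw [hρ]; positivity
  · rw [hρ, div_mul_eq_mul_div, div_lt_iff₀ (Real.exp_pos _), one_mul]
    calc Bw * M ^ e ≤ Real.exp B * Real.exp (e * Mb) := mul_le_mul hBw hMe hMepos.le (Real.exp_pos _).le
      _ = Real.exp (B + e * Mb) := by rw [← Real.exp_add]
      _ < Real.exp GE := Real.exp_lt_exp.mpr hfar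

end SatLineAlg

end Summit.ABC.StewartYu

end
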